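import Literature.NumberTheory.Transcendental.NesterenkoEliminationProp47HeightsProofs
import Literature.NumberTheory.Transcendental.NesterenkoEliminationNorms
import Mathlib.Analysis.Complex.ExponentialBounds
import HarnessLib

/-!
# LNM 1752 Ch. 3 Proposition 4.7 3) (values at a point) from Proposition 4.4, and Proposition 4.7 assembled — proofs only

Topic `Literature/NumberTheory/Transcendental`. Proofs-only sibling of
`NesterenkoEliminationFacts.lean`; no definitions, no named facts. Main results:

* `prod_iabs_pow_le` — **Proposition 4.7 3)** (LNM 1752 Ch. 3 §4, p. 39, `K = ℚ`, archimedean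
  absolute value, `𝒦 = ℂ`): `∑_Q k_Q log |√Q(ω̄)| ≤ log |I(ω̄)| + m³ deg I`, in the exponentiated
  form of the facts file, CONDITIONALLY on Proposition 4.4 (`h44`);
* `NesterenkoPhilippon2001_ch3_prop_4_7_of_prop_4_4` — **Proposition 4.7 ⇐ Proposition 4.4**:
  the named fact `NesterenkoPhilippon2001_ch3_prop_4_7` follows from the named fact
  `NesterenkoPhilippon2001_ch3_prop_4_4` (parts 1), 2) are `sum_primaryExponent_mul_ideg_eq`,
  `sum_primaryExponent_mul_iheight_le`). The discharge `…prop_4_7_holds` is therefore the one-liner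
  `…prop_4_7_of_prop_4_4 …prop_4_4_holds` once Proposition 4.4 is proved.

## The proof of 3)

With `F_I = c ∏ F_Q^{k_Q}` (Prop. 4.4) and `ϰ` a ring homomorphism, `ϰ(F_I) = c ∏ ϰ(F_Q)^{k_Q}`,
and `|I(ω̄)| = |ϰ(F_I)| |F_I|⁻¹ |ω̄|^{−r deg I}`, `|√Q(ω̄)| = |ϰ(F_Q)| |F_Q|⁻¹ |ω̄|^{−r deg √Q}`
(Def. 4.6) with `∑ k_Q deg √Q = deg I` (part 1). If some `ϰ(F_Q) = 0` the left side vanishes.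
Otherwise it remains to bound two losses:
* `∑ k_Q log |ϰ(F_Q)| − log |∏ ϰ(F_Q)^{k_Q}|` by Gelfond's lemma over `ℂ` applied AFTER setting one
  skew variable per block equal to `1` (`ϰ(F_Q)` is homogeneous of degree `deg √Q` in each block
  `s⁽ⁱ⁾`, `kappa_blockHom`): at most `r (M − 1) deg I`, `M = m(m+1)/2` the number of skew variables
  per block (`two_mul_card_skewIdx`);
* `log |∏ F_Q^{k_Q}| − ∑ k_Q log |F_Q|` by the trivial bound `|PQ| ≤ #supp(P) |P| |Q|` with
  `#supp F_Q ≤ (deg √Q + 1)^{rm} ≤ 2^{rm deg √Q}` (dehomogenised count): at most `r m deg I log 2`.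
Since `r ≤ m` and `(m² + m − 2)/2 + m log 2 ≤ m²` for every `m ≥ 1`, the total is `≤ m³ deg I`.

## References

* [NesterenkoPhilippon2001] Yu. V. Nesterenko, P. Philippon (eds.), *Introduction to Algebraic
  Independence Theory*, LNM 1752, Springer 2001, Ch. 3 §4: Prop. 4.4, Def. 4.5, Def. 4.6,
  Prop. 4.7 (pp. 38–39; PDF pp. 50–51).
* [Nes10] Yu. V. Nesterenko, Proc. Steklov Inst. Math. 218 (1997) 294–331, Prop. 1.2.
* [BombieriGubler2006] E. Bombieri, W. Gubler, *Heights in Diophantine Geometry*, §1.6, Lemma 1.6.11.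
-/

noncomputable section

open MvPolynomial Real Literature.NumberTheory.DiophantineGeometry

namespace Literature.NumberTheory.Transcendental

namespace Nesterenko

/-! ### Gelfond's lemma in terms of `|·|` (maximum modulus of the coefficients) -/

/-- `|f|` is attained at some coefficient. [folklore] -/
theorem exists_norm_coeff_eq_maxNorm {σ K : Type*} [NormedField K] {f : MvPolynomial σ K}
    (hf : f ≠ 0) : ∃ e ∈ f.support, ‖coeff e f‖ = maxNorm f := by
  classical
  have hne : f.support.Nonempty := by
    rw [Finset.nonempty_iff_ne_empty, Ne, support_eq_empty]
    exact hf
  obtain ⟨e, he, hmax⟩ := Finset.exists_max_image f.support (fun d => ‖coeff d f‖) hne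
  refine ⟨e, he, le_antisymm (norm_coeff_le_maxNorm f e) ?_⟩
  unfold maxNorm
  have h : (f.support.sup fun γ => ‖f.coeff γ‖₊) ≤ ‖f.coeff e‖₊ :=
    Finset.sup_le fun d hd => by
      have := hmax d hd
      exact_mod_cast this
  exact_mod_cast h

/-- **Gelfond's lemma for `|·|`** (over `ℂ`, any finite set of variables): for non-zero `f_j`,
`∑_j log |f_j| ≤ log |∏_j f_j| + ∑_v ∑_j deg_v f_j`.
[cite: BombieriGubler2006, §1.6, Lemma 1.6.11 (p. 27)] -/
theorem sum_log_maxNorm_le {σ ι : Type*} [Fintype σ] [DecidableEq σ] (s : Finset ι)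
    (f : ι → MvPolynomial σ ℂ) (hf : ∀ j ∈ s, f j ≠ 0) :
    ∑ j ∈ s, log (maxNorm (f j)) ≤
      log (maxNorm (∏ j ∈ s, f j)) + ∑ v, (∑ j ∈ s, degreeOf v (f j) : ℝ) := by
  classical
  have hmax : ∀ j ∈ s, ∃ e ∈ (f j).support, ‖coeff e (f j)‖ = maxNorm (f j) :=
    fun j hj => exists_norm_coeff_eq_maxNorm (hf j hj)
  choose! e he heq using hmax
  have hcoeff : ∀ j ∈ s, coeff (e j) (f j) ≠ 0 := fun j hj => mem_support_iff.mp (he j hj)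
  obtain ⟨e', he', hle⟩ := gelfond_lower_linear_fintype s f hf e hcoeff
  have h1 : ∑ j ∈ s, log (maxNorm (f j)) = ∑ j ∈ s, log ‖coeff (e j) (f j)‖ :=
    Finset.sum_congr rfl fun j hj => by rw [heq j hj]
  have h2 : log ‖coeff e' (∏ j ∈ s, f j)‖ ≤ log (maxNorm (∏ j ∈ s, f j)) :=
    Real.log_le_log (norm_pos_iff.mpr (mem_support_iff.mp he')) (norm_coeff_le_maxNorm _ _)
  linarith

/-- The trivial upper bound `|∏ f_j| ≤ ∏ (#supp f_j · |f_j|)`. [folklore] -/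
theorem maxNorm_prod_le_prod_card_mul {σ K ι : Type*} [NormedField K] (s : Finset ι)
    (f : ι → MvPolynomial σ K) :
    maxNorm (∏ j ∈ s, f j) ≤ ∏ j ∈ s, ((f j).support.card * maxNorm (f j)) := by
  classical
  induction s using Finset.induction_on with
  | empty => simpa using (maxNorm_one_le (σ := σ) (K := K))
  | insert a s ha ih =>
    rw [Finset.prod_insert ha, Finset.prod_insert ha]
    calc maxNorm (f a * ∏ j ∈ s, f j)
        ≤ (f a).support.card * maxNorm (f a) * maxNorm (∏ j ∈ s, f j) := maxNorm_mul_le _ _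
      _ ≤ (f a).support.card * maxNorm (f a) * ∏ j ∈ s, ((f j).support.card * maxNorm (f j)) :=
          mul_le_mul_of_nonneg_left ih (mul_nonneg (Nat.cast_nonneg _) (maxNorm_nonneg _))

/-! ### `ϰ` preserves block-homogeneity -/

variable {m : ℕ}

/-- The block-`i` weight of an exponent in variables `Fin r × α` is its degree in block `i`.
[folklore] -/
theorem weight_block_eq_sum {r : ℕ} {α : Type*} [Fintype α] (i : Fin r) (γ : Fin r × α →₀ ℕ) :
    Finsupp.weight (fun v : Fin r × α => if v.1 = i then (1 : ℕ) else 0) γ = ∑ a, γ (i, a) := by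
  classical
  rw [Finsupp.weight_apply, Finsupp.sum_fintype _ _ (fun v => by simp)]
  simp only [smul_eq_mul, mul_ite, mul_one, mul_zero]
  rw [Fintype.sum_prod_type, Finset.sum_eq_single i (fun i' _ hi' => by simp [hi'])
    (fun h => absurd (Finset.mem_univ i) h)]
  simp

/-- The linear forms `λ_{i'j}(ω̄)` substituted by `ϰ` are homogeneous of degree `[i' = i]` for the
weight of the skew block `i`. [folklore] -/
theorem lam_isWeightedHomogeneous {r : ℕ} (ω : Fin (m + 1) → ℂ) (i i' : Fin r) (j : Fin (m + 1)) :
    IsWeightedHomogeneous (fun v : Fin r × SkewIdx m => if v.1 = i then (1 : ℕ) else 0)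
      (lam ω i' j) (if i' = i then 1 else 0) := by
  have hX : ∀ p : SkewIdx m, IsWeightedHomogeneous
      (fun v : Fin r × SkewIdx m => if v.1 = i then (1 : ℕ) else 0) (X (i', p) : RS r m)
      (if i' = i then 1 else 0) := fun p => by
    simpa using isWeightedHomogeneous_X ℂ
      (fun v : Fin r × SkewIdx m => if v.1 = i then (1 : ℕ) else 0) (i', p)
  generalize hd : (if i' = i then (1 : ℕ) else 0) = d at hX ⊢
  unfold lam
  refine IsWeightedHomogeneous.sum _ _ _ fun k _ => ?_
  have hC : IsWeightedHomogeneous (fun v : Fin r × SkewIdx m => if v.1 = i then (1 : ℕ) else 0)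
      (C (ω k) : RS r m) 0 := isWeightedHomogeneous_C _ _
  have hsk : IsWeightedHomogeneous (fun v : Fin r × SkewIdx m => if v.1 = i then (1 : ℕ) else 0)
      (skewEntry i' j k : RS r m) d := by
    unfold skewEntry
    split_ifs with h1 h2
    · exact hX _
    · rw [← mem_weightedHomogeneousSubmodule]
      exact Submodule.neg_mem _ ((mem_weightedHomogeneousSubmodule _ _ _ _).mpr (hX _))
    · exact isWeightedHomogeneous_zero _ _ _
  simpa using hsk.mul hC

/-- **`ϰ` preserves block-homogeneity**: if every monomial of `F ∈ ℚ[u₁, …, u_r]` has degree `D i`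
in the block `uᵢ` for every `i`, then every monomial of `ϰ_ω̄(F)` has degree `D i` in the block of
skew variables `s⁽ⁱ⁾` (the substitution `u_{ij} ↦ (S⁽ⁱ⁾ω̄)_j` is linear and blockwise).
[cite: NesterenkoPhilippon2001, Ch. 3 Def. 4.6 (p. 39)] -/
theorem kappa_blockHom {r : ℕ} (ω : Fin (m + 1) → ℂ) (F : RU r m) {D : Fin r → ℕ}
    (hF : ∀ e ∈ F.support, ∀ i, ∑ j, e (i, j) = D i) :
    ∀ e ∈ (kappa ω F).support, ∀ i, ∑ p, e (i, p) = D i := by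
  intro e he i
  set w : Fin r × SkewIdx m → ℕ := fun v => if v.1 = i then 1 else 0 with hw
  have hhom : IsWeightedHomogeneous w (kappa ω F) (D i) := by
    rw [kappa_eq_sum]
    refine IsWeightedHomogeneous.sum _ _ _ fun γ hγ => ?_
    have hC : IsWeightedHomogeneous w (C ((F.coeff γ : ℚ) : ℂ) : RS r m) 0 :=
      isWeightedHomogeneous_C _ _
    have hprod : IsWeightedHomogeneous w (γ.prod fun v k => lam ω v.1 v.2 ^ k) (D i) := by
      rw [Finsupp.prod_fintype _ _ (fun v => by simp)]
      have h := IsWeightedHomogeneous.prod Finset.univ (fun v : Fin r × Fin (m + 1) => lam ω v.1 v.2 ^ γ v)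
        (fun v => γ v • (if v.1 = i then 1 else 0)) (w := w) fun v _ =>
          (lam_isWeightedHomogeneous ω i v.1 v.2).pow (γ v)
      have hsum : ∑ v : Fin r × Fin (m + 1), γ v • (if v.1 = i then (1 : ℕ) else 0) = D i := by
        rw [← hF γ hγ i, ← weight_block_eq_sum i γ, Finsupp.weight_apply,
          Finsupp.sum_fintype _ _ (fun v => by simp)]
      rwa [hsum] at h
    simpa using hC.mul hprod
  rw [← weight_block_eq_sum i e]
  exact hhom (mem_support_iff.mp he)

/-! ### Counting the skew variables -/

/-- `2 · #{(j, k) : 0 ≤ j < k ≤ m} = m (m + 1)`. [folklore] -/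
theorem two_mul_card_skewIdx (m : ℕ) : 2 * Fintype.card (SkewIdx m) = m * (m + 1) := by
  let eqv : SkewIdx m ≃ Σ b : Fin (m + 1), Fin b.val :=
    { toFun := fun p => ⟨p.1.2, ⟨p.1.1.val, p.2⟩⟩
      invFun := fun x => ⟨(⟨x.2.val, x.2.isLt.trans x.1.isLt⟩, x.1), x.2.isLt⟩
      left_inv := fun p => by
        rcases p with ⟨⟨a, b⟩, h⟩
        rfl
      right_inv := fun x => by
        rcases x with ⟨b, ⟨k, hk⟩⟩
        rfl }
  rw [Fintype.card_congr eqv, Fintype.card_sigma]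
  simp only [Fintype.card_fin]
  rw [Fin.sum_univ_eq_sum_range (fun b => b) (m + 1), mul_comm, Finset.sum_range_id_mul_two,
    Nat.add_sub_cancel, mul_comm]

/-- The number of skew variables left after dehomogenising one per block:
`2 · #(Fin r × {p ≠ p₀}) = r (m² + m − 2)`. [folklore] -/
theorem two_mul_card_skewVars (r : ℕ) (p₀ : SkewIdx m) :
    2 * Fintype.card (Fin r × {p : SkewIdx m // p ≠ p₀}) + 2 * r = r * (m * (m + 1)) := by
  classical
  rw [Fintype.card_prod, Fintype.card_fin, Fintype.card_subtype_compl, Fintype.card_subtype_eq]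
  have h := two_mul_card_skewIdx m
  have h1 : 1 ≤ Fintype.card (SkewIdx m) := Fintype.card_pos_iff.mpr ⟨p₀⟩
  zify [h1] at h ⊢
  linear_combination (r : ℤ) * h


/-! ### Supports -/

/-- A polynomial with partial degrees `d_v` has at most `∏_v (d_v + 1)` monomials (any finite set
of variables, any coefficients). [folklore] -/
theorem card_support_le_prod_degreeOf_succ' {σ R : Type*} [Fintype σ] [CommSemiring R]
    (f : MvPolynomial σ R) : f.support.card ≤ ∏ v, (degreeOf v f + 1) := by
  classical
  have h : f.support.card ≤
      (Fintype.piFinset fun v : σ => Finset.range (degreeOf v f + 1)).card := by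
    refine Finset.card_le_card_of_injOn (fun e v => e v) (fun e he => ?_) ?_
    · rw [Finset.mem_coe, Fintype.mem_piFinset]
      intro v
      exact Finset.mem_range.mpr (Nat.lt_succ_of_le (monomial_le_degreeOf v he))
    · intro e₁ _ e₂ _ h
      exact Finsupp.ext fun v => congrFun h v
  rw [Fintype.card_piFinset] at h
  simpa using h

/-! ### Proposition 4.7 3) -/

/-- `ϰ` is multiplicative on products of powers (it is a ring homomorphism). [folklore] -/
theorem kappa_prod_pow {r : ℕ} {ι : Type*} (ω : Fin (m + 1) → ℂ) (s : Finset ι) (f : ι → RU r m)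
    (k : ι → ℕ) : kappa ω (∏ j ∈ s, f j ^ k j) = ∏ j ∈ s, kappa ω (f j) ^ k j := by
  unfold kappa
  rw [map_prod]
  exact Finset.prod_congr rfl fun j _ => map_pow _ _ _

/-- `ϰ(c F) = c ϰ(F)`. [folklore] -/
theorem kappa_C_mul' {r : ℕ} (ω : Fin (m + 1) → ℂ) (c : ℚ) (F : RU r m) :
    kappa ω (C c * F) = C (c : ℂ) * kappa ω F := by
  rw [← kappa_C ω c]
  unfold kappa
  rw [map_mul]

/-- **LNM 1752 Ch. 3 Proposition 4.7 3)** (values; from Proposition 4.4; archimedean absolute value,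
`𝒦 = ℂ`). Let `I ⊂ ℚ[x₀, …, x_m]` be a homogeneous unmixed ideal with `dim I = r − 1`,
`1 ≤ r ≤ m`, `t` its reduced primary decomposition, `k_Q` the exponent of `Q ∈ t`, `ω̄ ∈ ℂ^{m+1}∖0`.
Then `∑_Q k_Q log |√Q(ω̄)| ≤ log |I(ω̄)| + m³ deg I`, in the exponentiated form
`∏_Q |√Q(ω̄)|^{k_Q} ≤ |I(ω̄)| e^{m³ deg I}`. See the module docstring for the proof.
[cite: NesterenkoPhilippon2001, Ch. 3 Prop. 4.7 3) (p. 39)] -/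
theorem prod_iabs_pow_le (h44 : NesterenkoPhilippon2001_ch3_prop_4_4) {r : ℕ}
    {I : Ideal (Rx m)} (hr1 : 1 ≤ r) (hrm : r ≤ m)
    (hIh : letI := MvPolynomial.gradedAlgebra (σ := Fin (m + 1)) (R := ℚ)
      I.IsHomogeneous (homogeneousSubmodule (Fin (m + 1)) ℚ)) (hI : IsUnmixedOfRank I r)
    {t : Finset (Ideal (Rx m))} (ht : Submodule.IsMinimalPrimaryDecomposition I t)
    {ω : Fin (m + 1) → ℂ} (hω : ω ≠ 0) :
    ∏ Q ∈ t, iabs Q.radical r ω ^ primaryExponent Q ≤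
      iabs I r ω * Real.exp ((m : ℝ) ^ 3 * ideg I r) := by
  classical
  have hr : 0 < r := hr1
  have hm : 1 ≤ m := hr1.trans hrm
  obtain ⟨hne, c, hc, hprod⟩ := exists_chowForm_eq_C_mul_prod h44 hr1 hrm hIh hI ht
  have hdeg := sum_primaryExponent_mul_ideg_eq h44 hr1 hrm hIh hI ht
  -- notation
  set Fj : Ideal (Rx m) → RU r m := fun Q => chowForm Q.radical r with hFj
  set D : Ideal (Rx m) → ℕ := fun Q => ideg Q.radical r with hD
  set k : Ideal (Rx m) → ℕ := fun Q => primaryExponent Q with hk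
  set G : RU r m := ∏ Q ∈ t, Fj Q ^ k Q with hG
  have hdeg' : ∑ Q ∈ t, k Q * D Q = ideg I r := hdeg
  -- the degenerate case: some `ϰ(F_Q) = 0`
  by_cases hzero : ∃ Q ∈ t, kappa ω (Fj Q) = 0
  · obtain ⟨Q, hQ, hQ0⟩ := hzero
    have hkQ : 0 < k Q := primaryExponent_pos (ht.primary hQ).ne_top
    have hfac : iabs Q.radical r ω ^ k Q = 0 := by
      have h0 : iabs Q.radical r ω = 0 := by
        change maxNorm (kappa ω (Fj Q)) / _ = 0
        rw [hQ0, maxNorm_zero, zero_div]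
      rw [h0, zero_pow hkQ.ne']
    rw [Finset.prod_eq_zero hQ hfac]
    exact mul_nonneg (iabs_nonneg _ _ _) (Real.exp_pos _).le
  simp only [not_exists, not_and] at hzero
  -- positivity of all the quantities
  have hw : 0 < ‖ω‖ := norm_pos_iff.mpr hω
  have hA : ∀ Q ∈ t, 0 < maxNorm (kappa ω (Fj Q)) := fun Q hQ => maxNorm_pos (hzero Q hQ)
  have hB : ∀ Q ∈ t, 0 < maxNorm (Fj Q) := fun Q hQ => maxNorm_pos (hne Q hQ)
  have hKG : kappa ω G = ∏ Q ∈ t, kappa ω (Fj Q) ^ k Q := kappa_prod_pow ω t Fj k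
  have hKG0 : kappa ω G ≠ 0 := by
    rw [hKG]
    exact Finset.prod_ne_zero_iff.mpr fun Q hQ => pow_ne_zero _ (hzero Q hQ)
  have hG0 : G ≠ 0 := Finset.prod_ne_zero_iff.mpr fun Q hQ => pow_ne_zero _ (hne Q hQ)
  have hAG : 0 < maxNorm (kappa ω G) := maxNorm_pos hKG0
  have hBG : 0 < maxNorm G := maxNorm_pos hG0
  -- the two sides
  have hLHS : ∏ Q ∈ t, iabs Q.radical r ω ^ k Q =
      (∏ Q ∈ t, maxNorm (kappa ω (Fj Q)) ^ k Q) /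
        ((∏ Q ∈ t, maxNorm (Fj Q) ^ k Q) * ‖ω‖ ^ (r * ideg I r)) := by
    have h1 : ∀ Q ∈ t, iabs Q.radical r ω ^ k Q =
        maxNorm (kappa ω (Fj Q)) ^ k Q / (maxNorm (Fj Q) ^ k Q * ‖ω‖ ^ (r * (k Q * D Q))) := by
      intro Q _
      change (maxNorm (kappa ω (Fj Q)) / (maxNorm (Fj Q) * ‖ω‖ ^ (r * D Q))) ^ k Q = _
      rw [div_pow, mul_pow, ← pow_mul]
      congr 2
      ring
    rw [Finset.prod_congr rfl h1, Finset.prod_div_distrib, Finset.prod_mul_distrib,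
      Finset.prod_pow_eq_pow_sum, ← Finset.mul_sum, hdeg']
  have hRHS : iabs I r ω = maxNorm (kappa ω G) / (maxNorm G * ‖ω‖ ^ (r * ideg I r)) := by
    change maxNorm (kappa ω (chowForm I r)) / (maxNorm (chowForm I r) * ‖ω‖ ^ (r * ideg I r)) = _
    rw [hprod, kappa_C_mul', maxNorm_C_mul, maxNorm_C_mul, norm_ratCast_eq, mul_assoc,
      mul_div_mul_left _ _ (norm_ne_zero_iff.mpr hc)]
  -- block-homogeneity on both sides
  have hblk : ∀ Q, ∀ e ∈ (Fj Q).support, ∀ i : Fin r, ∑ a, e (i, a) = D Q :=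
    fun Q e he i => bdeg_eq_ideg_of_mem_support_chowForm Q.radical hr he i
  have hGsupp : G.support = (chowForm I r).support := by
    have hG' : G = C c⁻¹ * chowForm I r := by
      rw [hprod, ← mul_assoc, ← C_mul, inv_mul_cancel₀ hc, C_1, one_mul]
    rw [hG', C_mul', support_smul_eq (inv_ne_zero hc)]
  have hblkG : ∀ e ∈ G.support, ∀ i : Fin r, ∑ a, e (i, a) = ideg I r := fun e he i =>
    bdeg_eq_ideg_of_mem_support_chowForm I hr (hGsupp ▸ he) i
  have hKblk : ∀ Q, ∀ e ∈ (kappa ω (Fj Q)).support, ∀ i : Fin r, ∑ p, e (i, p) = D Q :=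
    fun Q => kappa_blockHom ω (Fj Q) (hblk Q)
  have hKblkG : ∀ e ∈ (kappa ω G).support, ∀ i : Fin r, ∑ p, e (i, p) = ideg I r :=
    kappa_blockHom ω G hblkG
  -- (i) the `s`-side: dehomogenise one skew variable per block and apply Gelfond's lemma
  set p₀ : SkewIdx m := ⟨(⟨0, by omega⟩, ⟨1, by omega⟩), Fin.mk_lt_mk.mpr Nat.zero_lt_one⟩ with hp₀
  have hinjK : ∀ Q, Set.InjOn (dehomIdx (r := r) p₀) (kappa ω (Fj Q)).support := fun Q =>
    injOn_dehomIdx p₀ (S := ((kappa ω (Fj Q)).support : Set _)) (D := fun _ => D Q)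
      fun e he i => hKblk Q e he i
  have hinjKG : Set.InjOn (dehomIdx (r := r) p₀) (kappa ω G).support :=
    injOn_dehomIdx p₀ (S := ((kappa ω G).support : Set _)) (D := fun _ => ideg I r)
      fun e he i => hKblkG e he i
  set KF : Ideal (Rx m) → MvPolynomial (Fin r × {p : SkewIdx m // p ≠ p₀}) ℂ :=
    fun Q => dehom ℂ p₀ (kappa ω (Fj Q)) with hKF
  have hKF0 : ∀ Q ∈ t, KF Q ≠ 0 := fun Q hQ => dehom_ne_zero p₀ (hinjK Q) (hzero Q hQ)
  have hKF_norm : ∀ Q, maxNorm (KF Q) = maxNorm (kappa ω (Fj Q)) := fun Q =>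
    maxNorm_dehom p₀ _ (hinjK Q)
  have hKF_deg : ∀ Q (v : Fin r × {p : SkewIdx m // p ≠ p₀}), degreeOf v (KF Q) ≤ D Q :=
    fun Q v => degreeOf_dehom_le p₀ _ (D := fun _ => D Q) (hKblk Q) v.1 v.2
  have hKGd : dehom ℂ p₀ (kappa ω G) = ∏ Q ∈ t, KF Q ^ k Q := by
    rw [hKG, map_prod]
    exact Finset.prod_congr rfl fun Q _ => by rw [map_pow]
  have hKG_norm : maxNorm (dehom ℂ p₀ (kappa ω G)) = maxNorm (kappa ω G) :=
    maxNorm_dehom p₀ _ hinjKG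
  have hside_s : ∑ Q ∈ t, (k Q : ℝ) * Real.log (maxNorm (kappa ω (Fj Q))) ≤
      Real.log (maxNorm (kappa ω G)) +
        (Fintype.card (Fin r × {p : SkewIdx m // p ≠ p₀}) : ℝ) * ideg I r := by
    have h := sum_log_maxNorm_le (t.sigma fun Q => Finset.range (k Q)) (fun x => KF x.1)
      fun x hx => hKF0 x.1 (Finset.mem_sigma.mp hx).1
    have hprodK : ∏ x ∈ t.sigma (fun Q => Finset.range (k Q)), KF x.1 = dehom ℂ p₀ (kappa ω G) := by
      rw [Finset.prod_sigma, hKGd]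
      refine Finset.prod_congr rfl fun Q _ => ?_
      simp only [Finset.prod_const, Finset.card_range]
    have hsumK : ∑ x ∈ t.sigma (fun Q => Finset.range (k Q)), Real.log (maxNorm (KF x.1)) =
        ∑ Q ∈ t, (k Q : ℝ) * Real.log (maxNorm (kappa ω (Fj Q))) := by
      rw [Finset.sum_sigma]
      refine Finset.sum_congr rfl fun Q _ => ?_
      simp only [Finset.sum_const, Finset.card_range, nsmul_eq_mul, hKF_norm]
    have hdegK : ∑ v, (∑ x ∈ t.sigma (fun Q => Finset.range (k Q)), degreeOf v (KF x.1) : ℝ) ≤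
        (Fintype.card (Fin r × {p : SkewIdx m // p ≠ p₀}) : ℝ) * ideg I r := by
      have h1 : ∀ v : Fin r × {p : SkewIdx m // p ≠ p₀},
          (∑ x ∈ t.sigma (fun Q => Finset.range (k Q)), degreeOf v (KF x.1) : ℝ) ≤ ideg I r := by
        intro v
        rw [Finset.sum_sigma, ← hdeg']
        push_cast
        refine Finset.sum_le_sum fun Q _ => ?_
        simp only [Finset.sum_const, Finset.card_range, nsmul_eq_mul]
        exact mul_le_mul_of_nonneg_left (by exact_mod_cast hKF_deg Q v) (Nat.cast_nonneg _)
      calc ∑ v, (∑ x ∈ t.sigma (fun Q => Finset.range (k Q)), degreeOf v (KF x.1) : ℝ)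
          ≤ ∑ _v : Fin r × {p : SkewIdx m // p ≠ p₀}, (ideg I r : ℝ) := Finset.sum_le_sum fun v _ => h1 v
        _ = (Fintype.card (Fin r × {p : SkewIdx m // p ≠ p₀}) : ℝ) * ideg I r := by
            rw [Finset.sum_const, Finset.card_univ, nsmul_eq_mul]
    rw [hprodK, hKG_norm, hsumK] at h
    linarith
  -- (ii) the `u`-side: the trivial upper bound with the dehomogenised count of monomials
  set a₀ : Fin (m + 1) := 0 with ha₀
  have hinjF : ∀ Q, Set.InjOn (dehomIdx (r := r) a₀) (Fj Q).support := fun Q =>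
    injOn_dehomIdx a₀ (S := ((Fj Q).support : Set _)) (D := fun _ => D Q) fun e he i => hblk Q e he i
  have hcard : ∀ Q ∈ t, ((Fj Q).support.card : ℝ) ≤ (2 : ℝ) ^ (r * m * D Q) := by
    intro Q _
    have h1 : (Fj Q).support.card = (dehom ℚ a₀ (Fj Q)).support.card :=
      (card_support_dehom a₀ (Fj Q) (hinjF Q)).symm
    have h2 := card_support_le_prod_degreeOf_succ' (dehom ℚ a₀ (Fj Q))
    have h3 : ∏ v, (degreeOf v (dehom ℚ a₀ (Fj Q)) + 1) ≤
        ∏ _v : Fin r × {a : Fin (m + 1) // a ≠ a₀}, 2 ^ D Q := by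
      refine Finset.prod_le_prod' fun v _ => ?_
      have hle : degreeOf v (dehom ℚ a₀ (Fj Q)) ≤ D Q :=
        degreeOf_dehom_le a₀ (Fj Q) (D := fun _ => D Q) (hblk Q) v.1 v.2
      exact (Nat.succ_le_succ hle).trans (D Q).lt_two_pow_self.succ_le
    rw [Finset.prod_const, Finset.card_univ, card_blockVars, ← pow_mul, mul_comm (D Q)] at h3
    exact_mod_cast h1.le.trans (h2.trans h3)
  have hside_u : Real.log (maxNorm G) ≤
      ∑ Q ∈ t, (k Q : ℝ) * Real.log (maxNorm (Fj Q)) + (r * m : ℝ) * ideg I r * Real.log 2 := by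
    have h := maxNorm_prod_le_prod_card_mul (t.sigma fun Q => Finset.range (k Q)) (fun x => Fj x.1)
    have hprodF : ∏ x ∈ t.sigma (fun Q => Finset.range (k Q)), Fj x.1 = G := by
      rw [Finset.prod_sigma, hG]
      refine Finset.prod_congr rfl fun Q _ => ?_
      simp only [Finset.prod_const, Finset.card_range]
    rw [hprodF] at h
    have hpos : ∀ x ∈ t.sigma (fun Q => Finset.range (k Q)),
        0 < ((Fj x.1).support.card : ℝ) * maxNorm (Fj x.1) := by
      intro x hx
      have hQ := (Finset.mem_sigma.mp hx).1
      refine mul_pos ?_ (hB x.1 hQ)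
      have : (Fj x.1).support.Nonempty := by
        rw [Finset.nonempty_iff_ne_empty, Ne, support_eq_empty]
        exact hne x.1 hQ
      exact_mod_cast this.card_pos
    have hlog := Real.log_le_log hBG h
    rw [Real.log_prod (fun x hx => (hpos x hx).ne')] at hlog
    have hterm : ∀ x ∈ t.sigma (fun Q => Finset.range (k Q)),
        Real.log (((Fj x.1).support.card : ℝ) * maxNorm (Fj x.1)) ≤
          Real.log (maxNorm (Fj x.1)) + (r * m : ℝ) * D x.1 * Real.log 2 := by
      intro x hx
      have hQ := (Finset.mem_sigma.mp hx).1
      have hcpos : (0 : ℝ) < (Fj x.1).support.card := by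
        have : (Fj x.1).support.Nonempty := by
          rw [Finset.nonempty_iff_ne_empty, Ne, support_eq_empty]
          exact hne x.1 hQ
        exact_mod_cast this.card_pos
      rw [Real.log_mul hcpos.ne' (hB x.1 hQ).ne', add_comm]
      gcongr
      calc Real.log ((Fj x.1).support.card : ℝ) ≤ Real.log ((2 : ℝ) ^ (r * m * D x.1)) :=
            Real.log_le_log hcpos (hcard x.1 hQ)
        _ = (r * m : ℝ) * D x.1 * Real.log 2 := by
            rw [Real.log_pow]
            push_cast
            ring
    have hsum := Finset.sum_le_sum hterm
    have hsumF : ∑ x ∈ t.sigma (fun Q => Finset.range (k Q)),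
        (Real.log (maxNorm (Fj x.1)) + (r * m : ℝ) * D x.1 * Real.log 2) =
        ∑ Q ∈ t, (k Q : ℝ) * Real.log (maxNorm (Fj Q)) + (r * m : ℝ) * ideg I r * Real.log 2 := by
      rw [Finset.sum_sigma, ← hdeg']
      push_cast
      rw [Finset.mul_sum, Finset.sum_mul, ← Finset.sum_add_distrib]
      refine Finset.sum_congr rfl fun Q _ => ?_
      simp only [Finset.sum_const, Finset.card_range, nsmul_eq_mul]
      ring
    rw [hsumF] at hsum
    linarith
  -- (iii) the numerical bound on the total loss
  have hnum : (Fintype.card (Fin r × {p : SkewIdx m // p ≠ p₀}) : ℝ) * ideg I r +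
      (r * m : ℝ) * ideg I r * Real.log 2 ≤ (m : ℝ) ^ 3 * ideg I r := by
    have hcs := two_mul_card_skewVars r p₀
    have hl2 : Real.log 2 < 0.6931471808 := Real.log_two_lt_d9
    have hDI0 : (0 : ℝ) ≤ ideg I r := Nat.cast_nonneg _
    have hrm' : (r : ℝ) ≤ m := by exact_mod_cast hrm
    have hr0 : (0 : ℝ) ≤ r := Nat.cast_nonneg _
    have hm1 : (1 : ℝ) ≤ m := by exact_mod_cast hm
    have hcsR : 2 * (Fintype.card (Fin r × {p : SkewIdx m // p ≠ p₀}) : ℝ) + 2 * r =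
        r * (m * (m + 1)) := by exact_mod_cast hcs
    -- the loss per unit of `deg I` is `cs + r m log 2 ≤ m (m² + m − 2)/2 + 0.7 m² ≤ m³`
    have hbound : (Fintype.card (Fin r × {p : SkewIdx m // p ≠ p₀}) : ℝ) + (r * m : ℝ) * Real.log 2 ≤
        (m : ℝ) ^ 3 := by
      have hl2' : (0 : ℝ) ≤ Real.log 2 := Real.log_nonneg one_le_two
      nlinarith [mul_le_mul_of_nonneg_right hrm' (by nlinarith : (0 : ℝ) ≤ m * (m + 1) - 2),
        mul_le_mul_of_nonneg_right hrm' (mul_nonneg (Nat.cast_nonneg m) hl2'),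
        sq_nonneg ((m : ℝ) - 1.1932)]
    have := mul_le_mul_of_nonneg_right hbound hDI0
    nlinarith
  -- assemble: compare logarithms
  have hLpos : 0 < (∏ Q ∈ t, maxNorm (kappa ω (Fj Q)) ^ k Q) /
      ((∏ Q ∈ t, maxNorm (Fj Q) ^ k Q) * ‖ω‖ ^ (r * ideg I r)) :=
    div_pos (Finset.prod_pos fun Q hQ => pow_pos (hA Q hQ) _)
      (mul_pos (Finset.prod_pos fun Q hQ => pow_pos (hB Q hQ) _) (pow_pos hw _))
  have hRpos : 0 < maxNorm (kappa ω G) / (maxNorm G * ‖ω‖ ^ (r * ideg I r)) *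
      Real.exp ((m : ℝ) ^ 3 * ideg I r) :=
    mul_pos (div_pos hAG (mul_pos hBG (pow_pos hw _))) (Real.exp_pos _)
  rw [hLHS, hRHS, ← Real.log_le_log_iff hLpos hRpos]
  rw [Real.log_div (Finset.prod_pos fun Q hQ => pow_pos (hA Q hQ) _).ne'
      (mul_pos (Finset.prod_pos fun Q hQ => pow_pos (hB Q hQ) _) (pow_pos hw _)).ne',
    Real.log_mul (Finset.prod_pos fun Q hQ => pow_pos (hB Q hQ) _).ne' (pow_pos hw _).ne',
    Real.log_prod (fun Q hQ => (pow_pos (hA Q hQ) _).ne'),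
    Real.log_prod (fun Q hQ => (pow_pos (hB Q hQ) _).ne'),
    Real.log_mul (div_pos hAG (mul_pos hBG (pow_pos hw _))).ne' (Real.exp_pos _).ne',
    Real.log_div hAG.ne' (mul_pos hBG (pow_pos hw _)).ne', Real.log_mul hBG.ne' (pow_pos hw _).ne',
    Real.log_exp]
  simp only [Real.log_pow]
  linarith

/-! ### Proposition 4.7 from Proposition 4.4 -/

/-- **LNM 1752 Ch. 3 Proposition 4.7 ⇐ Proposition 4.4.** The named fact
`NesterenkoPhilippon2001_ch3_prop_4_7` (degree, height and value of an unmixed ideal versus those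
of its associated primes) follows from the named fact `NesterenkoPhilippon2001_ch3_prop_4_4`
(structure of the associated form), by parts 1) `sum_primaryExponent_mul_ideg_eq`,
2) `sum_primaryExponent_mul_iheight_le` and 3) `prod_iabs_pow_le`.
[cite: NesterenkoPhilippon2001, Ch. 3 Prop. 4.7 (p. 39)] -/
theorem NesterenkoPhilippon2001_ch3_prop_4_7_of_prop_4_4
    (h44 : NesterenkoPhilippon2001_ch3_prop_4_4) : NesterenkoPhilippon2001_ch3_prop_4_7 := by
  intro m r I hr1 hrm hIh hI t ht ω hω
  exact ⟨sum_primaryExponent_mul_ideg_eq h44 hr1 hrm hIh hI ht,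
    sum_primaryExponent_mul_iheight_le h44 hr1 hrm hIh hI ht,
    prod_iabs_pow_le h44 hr1 hrm hIh hI ht hω⟩

end Nesterenko

end Literature.NumberTheory.Transcendental

end
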